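import Summits.QuantumFields.YangMills.Theorems.FluctuationComparisonRegPrIntLS1aDomBGOfOneStepLetters
import Literature.MathematicalPhysics.QuantumFieldTheory.Balaban1983to89.T4AveragingDisintegration
import HarnessLib

/-!
# S1a · THE ONE-STEP CONDITIONAL PLATEAU LETTER `(L_i)` FROM A POINTWISE BOUND ON BAŁABAN'S RENORMALIZATION TRANSFORM OF THE OFF-PLATEAU PART, AND
# `hdomBG_j` FROM PER-HEIGHT TRANSPORT LETTERS (the set form of ✓`…S1aDomBGOfOneStepLetters` ⟸ «`T_i(ρ_{i+1}) ≤ e^{η_i}·T_i(1_{T_{i+1}}ρ_{i+1})` a.e. on good data»)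

Cell `ym3-torus` (YM ladder rung R3 = continuum `SU(2)` Yang–Mills on the three-torus — a RUNG: NOT d = 4, NOT infinite volume, NOT a mass gap, NOT Clay).
Width seat «width 8» `ym3-torus-px8` (gen 26), FREE px helper on crux `stmt-QuantumFields-20520`, count-neutral, DEFINITION-FREE, default heartbeats.  FILE 2 of the
seat (FILE 1 = ✓`…S1aDomBGOfOneStepLetters`: `hdomBG_j` ⟸ one-step conditional plateau letters `(L_i)` in SET form).

WHY.  FILE 1 left, as the whole analytic content of the (m)_E node's cut-height letter `hdomBG_j`, ONE sentence per height in set form: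
`(L_i) ∀ A ⊆ D_i: ν K (i+1){Ū ∈ A} ≤ e^{η_i}·ν K (i+1){Ū ∈ A, U ∈ T_{i+1}}`.  A supplier proves such a thing POINTWISE over the one-step fibre: Bałaban's
renormalization transformation `(Tρ)(V) = ∫ dU δ(ŪV⁻¹) ρ(U)` ([Balaban1987RG1] (0.13) p.254) applied to the off-plateau part of the density is small relative to `Tρ` on good
data — the mechanism of [Balaban1985UV3] (7) p.257 ∕ (47) p.267 (decomposition of unity inserted at ONE level; the large-field term is relatively small).  The tree reads `T`
as a KERNEL: lit ✓`T4AveragingDisintegration.kernelTransport dU_{i+1} dU_i (descend F ℰp i)` = «marginal density × integral against the conditional law of product Haar given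
the one-step average» with the push-forward identity `∫ (Tρ)·f dU_i = ∫ ρ·(f ∘ descend) dU_{i+1}` (`integral_kernelTransport_mul`, under `descend_* dU_{i+1} ≪ dU_i` =
✓`OrganTangentFibreMeanTools.absolutelyContinuous_map_descend`).  THIS FILE is the junction: the a.e. pointwise transport bound ⟹ `(L_i)`, and, composed with FILE 1, the
door's `hdomBG_j` from per-height TRANSPORT letters — also with the run's densities taken to be print's own `ρ_{K−(i+1)}` (lit `T3TiltDescent.heightDensity … univ`).

WHAT (0 `def`, 0 `sorry`; nothing of Bałaban's asserted — every transport letter is a HYPOTHESIS).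
§0 `withDensity_apply_eq_ofReal_integral_mul_indicator` [folklore]; §0b `kernelTransport_const_mul`, `indicator_const_mul`, `transportBound_const_mul` (the transport is linear:
   a relative bound survives scaling the density by `c ≥ 0`, e.g. `Z_K⁻¹`).
§1 ★★★`oneStepLetter_of_transportBound` — law `ν'` with integrable density `ρ ≥ 0` w.r.t. `dU_{i+1}`, good data `D`, measurable target `T'`: if for `dU_i`-a.e. `V ∈ D`
   `T(ρ)(V) ≤ e^{η}·T(1_{T'}ρ)(V)`, then `ν'(descend⁻¹A) ≤ e^{η}·ν'(descend⁻¹A ∩ T')` for every measurable `A ⊆ D` (both masses are `∫ ρ·(1_A ∘ descend)`, moved through the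
   transport with the bounded test function `1_A`; `integral_mono_ae`).
§2 ★★★`hdomBG_of_transportLetters` — in the tower door's scope (cut weights also measurable): integrable densities `ρr i ≥ 0` of `ν K i` (`j < i ≤ Ts`), open domains, measurable
   plateau targets `T_i ⊆ D_i`, transport letters at every height `j ≤ i < Ts`, `Σ_{[j,Ts)} η_i ≤ Δ` ⟹ the door's `hdomBG_j` binder VERBATIM (§1 feeds FILE 1's `hstep`).
§3 ★★★`hdomBG_of_transportLetters_heightDensity` — the same with `ρr (i+1) := ρ_{K−(i+1)}` = lit `heightDensity F γ _ univ` (run law = `dU·ofReal(Z_K⁻¹·ρ)`,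
   ✓`…S1aTowerLawSandwich.run_eq_withDensity_heightDensity_univ`; integrability lit `heightDensity_props`; `Z_K⁻¹` removed by §0b); `γ ≥ 0`.

THE RESIDUAL, NAMED (★p1; nothing asserted).  After FILE 1 + FILE 2 the cut-height letter `hdomBG_j` of the (m)_E node is, BY KERNEL, the family of TRANSPORT LETTERS
«`T_i(ρ_{K−(i+1)}) ≤ e^{η_i}·T_i(1_{T_{i+1}}ρ_{K−(i+1)})` `dU_i`-a.e. on `D_i`», `j ≤ i < Ts`, with `η_i ≤ c·q^i` (FILE 1 §0) — print's ONE-STEP large-field statement, whose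
inputs are the class bounds for the run at heights `i, i+1` ((41)∕(47)), the classical coercivity of the background action on the one-step fibre ([Balaban1985BackgroundPropagators]
§3), and fibre entropy (UV3-NODE §69.19).  HONEST: measure-theoretic bookkeeping over landed kernel facts and lit `T4AveragingDisintegration`; nothing of Bałaban's
renormalisation-group analysis asserted or proved; `hdomBG_j` REDUCED, not discharged; (m) AS TYPED suspect-false at `L = 3` (RULING №105), (m)_E OPEN; (α) UNINHABITED; the
five registered stubs (3732b7df) ∕ 20520 ∕ 19936 ∕ 19200 ∕ `YM3TorusSU2` NOT proved; rung R3 = SU(2) YM₃ on T³ — NOT d = 4, NOT infinite volume, NOT a mass gap, NOT Clay.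
References: [Balaban1985UV3] CMP 102 (1985) (2) p.256, (7) p.257, (41) p.266, (47) p.267; [Balaban1987RG1] CMP 109 (1987) (0.11)∕(0.13) pp.253–254.
-/

set_option autoImplicit false

noncomputable section

namespace Summit.QuantumFields.YangMills.Theorems.FluctuationComparisonRegPrIntLS1aOneStepLetterOfTransportBound

open MeasureTheory Filter Topology Set Function
open scoped ENNReal NNReal
open Literature.MathematicalPhysics.QuantumFieldTheory.Balaban1983to89
open T3ContinuumYM3Torus T3NestedUnitLaws T3UnitLawDensityEML T3LevelShift
open Literature.MathematicalPhysics.QuantumFieldTheory.Balaban1983to89.T4AveragingDisintegration (kernelTransport integral_kernelTransport_mul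
  integrable_kernelTransport kernelTransport_nonneg)
open Summit.QuantumFields.YangMills.Theorems.OrganTangentFibreMeanTools (absolutelyContinuous_map_descend)

/-! ## §0 Real ∕ extended-real bookkeeping for a law with an integrable non-negative density -/

section Density

variable {X : Type*} [MeasurableSpace X]

/-- A law with integrable density `ρ ≥ 0` charges a measurable set by `ofReal` of the real integral of `ρ · 1_S`. [folklore] -/
theorem withDensity_apply_eq_ofReal_integral_mul_indicator {μ : Measure X} {ρ : X → ℝ} (hρi : Integrable ρ μ) (hρ0 : ∀ x, 0 ≤ ρ x)
    {S : Set X} (hS : MeasurableSet S) :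
    μ.withDensity (fun x => ENNReal.ofReal (ρ x)) S = ENNReal.ofReal (∫ x, ρ x * S.indicator (fun _ => (1 : ℝ)) x ∂μ) := by
  have e : (fun x => ρ x * S.indicator (fun _ => (1 : ℝ)) x) = S.indicator ρ := by
    funext x
    by_cases hx : x ∈ S
    · simp [hx]
    · simp [hx]
  rw [withDensity_apply _ hS, e, integral_indicator hS,
    ofReal_integral_eq_lintegral_ofReal hρi.integrableOn (ae_of_all _ fun x => hρ0 x)]

end Density

/-! ## §0b The transport is linear in the density: scaling a transport bound by a constant `c ≥ 0` -/

section Linear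

variable {α β : Type*} [MeasurableSpace α] [MeasurableSpace β] [StandardBorelSpace β] [Nonempty β]

/-- `T(c·ρ) = c·T(ρ)` pointwise (the kernel transport is an integral against a kernel times a marginal density). [folklore] -/
theorem kernelTransport_const_mul (ν : Measure β) [IsFiniteMeasure ν] (μ : Measure α) (avg : β → α) (c : ℝ) (ρ : β → ℝ) (V : α) :
    kernelTransport ν μ avg (fun U => c * ρ U) V = c * kernelTransport ν μ avg ρ V := by
  simp only [kernelTransport, integral_const_mul]
  ring

/-- The indicator of a scaled density is the scaled indicator. [folklore] -/
theorem indicator_const_mul {X : Type*} (S : Set X) (c : ℝ) (ρ : X → ℝ) :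
    S.indicator (fun U => c * ρ U) = fun U => c * S.indicator ρ U := by
  funext U
  by_cases hU : U ∈ S
  · simp [hU]
  · simp [hU]

/-- A transport bound `T(ρ) ≤ e^η·T(1_S ρ)` at a point survives scaling the density by `c ≥ 0`. [folklore] -/
theorem transportBound_const_mul (ν : Measure β) [IsFiniteMeasure ν] (μ : Measure α) (avg : β → α) {c : ℝ} (hc : 0 ≤ c)
    (ρ : β → ℝ) (S : Set β) (η : ℝ) {V : α}
    (h : kernelTransport ν μ avg ρ V ≤ Real.exp η * kernelTransport ν μ avg (S.indicator ρ) V) :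
    kernelTransport ν μ avg (fun U => c * ρ U) V ≤ Real.exp η * kernelTransport ν μ avg (S.indicator fun U => c * ρ U) V := by
  rw [indicator_const_mul, kernelTransport_const_mul, kernelTransport_const_mul, mul_left_comm]
  exact mul_le_mul_of_nonneg_left h hc

end Linear

/-! ## §1 The letter `(L_i)` from the transport bound -/

section Letter

variable (F : T3Family)

/-- ★★★ **THE ONE-STEP CONDITIONAL PLATEAU LETTER FROM A POINTWISE TRANSPORT BOUND.**  Let `ν'` be a law on run `K`'s height-`(i+1)` fields with an integrable density
`ρ ≥ 0` w.r.t. product Haar `dU_{i+1}` (S1aᴴ's `ν K (i+1)`), `T := kernelTransport dU_{i+1} dU_i (descend F ℰp i)` the ONE-STEP RENORMALIZATION TRANSFORM read as a kernel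
(lit ✓`T4AveragingDisintegration`: `(Tρ)(V) = h(V)·∫ ρ d(condLaw V)`, the disintegration of product Haar along Bałaban's descent; `descend_* dU_{i+1} ≪ dU_i` is
✓`OrganTangentFibreMeanTools.absolutelyContinuous_map_descend`), `D` the good data, `T'` a measurable target.  IF for `dU_i`-a.e. good datum `V ∈ D`
`(Tρ)(V) ≤ e^{η} · (T(1_{T'}·ρ))(V)` — «the transform of the WHOLE density is at most `e^η` times the transform of its ON-PLATEAU part», i.e. the off-plateau part
`T((1 − 1_{T'})ρ)` is relatively small on good data ((47)'s mechanism, [Balaban1985UV3] p.267) — THEN the set-form letter of ✓`…S1aDomBGOfOneStepLetters` holds: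
`ν' (descend⁻¹ A) ≤ e^{η} · ν' (descend⁻¹ A ∩ T')` for every measurable `A ⊆ D`.  Nothing of Bałaban's asserted; the transport bound is the HYPOTHESIS.
[cite: Balaban1985UV3, (7) p.257 and (47) p.267] -/
theorem oneStepLetter_of_transportBound (i : ℕ)
    {ν' : Measure (GaugeField (F.P (i + 1)) 0 ↥(Matrix.specialUnitaryGroup (Fin 2) ℂ))}
    {ρ : GaugeField (F.P (i + 1)) 0 ↥(Matrix.specialUnitaryGroup (Fin 2) ℂ) → ℝ}
    (hρi : Integrable ρ (fieldMeasure (F.P (i + 1)) 0 ↥(Matrix.specialUnitaryGroup (Fin 2) ℂ))) (hρ0 : ∀ U, 0 ≤ ρ U)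
    (hν : ν' = (fieldMeasure (F.P (i + 1)) 0 ↥(Matrix.specialUnitaryGroup (Fin 2) ℂ)).withDensity fun U => ENNReal.ofReal (ρ U))
    (D : Set (GaugeField (F.P i) 0 ↥(Matrix.specialUnitaryGroup (Fin 2) ℂ)))
    {T' : Set (GaugeField (F.P (i + 1)) 0 ↥(Matrix.specialUnitaryGroup (Fin 2) ℂ))} (hTm : MeasurableSet T') {η : ℝ}
    (hKL : ∀ᵐ V ∂(fieldMeasure (F.P i) 0 ↥(Matrix.specialUnitaryGroup (Fin 2) ℂ)), V ∈ D →
      kernelTransport (fieldMeasure (F.P (i + 1)) 0 ↥(Matrix.specialUnitaryGroup (Fin 2) ℂ)) (fieldMeasure (F.P i) 0 ↥(Matrix.specialUnitaryGroup (Fin 2) ℂ))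
          (descend F ℰp i) ρ V ≤
        Real.exp η * kernelTransport (fieldMeasure (F.P (i + 1)) 0 ↥(Matrix.specialUnitaryGroup (Fin 2) ℂ))
          (fieldMeasure (F.P i) 0 ↥(Matrix.specialUnitaryGroup (Fin 2) ℂ)) (descend F ℰp i) (T'.indicator ρ) V)
    {A : Set (GaugeField (F.P i) 0 ↥(Matrix.specialUnitaryGroup (Fin 2) ℂ))} (hA : MeasurableSet A) (hAD : A ⊆ D) :
    ν' (descend F ℰp i ⁻¹' A) ≤ ENNReal.ofReal (Real.exp η) * ν' (descend F ℰp i ⁻¹' A ∩ T') := by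
  -- names
  set dU := fieldMeasure (F.P (i + 1)) 0 ↥(Matrix.specialUnitaryGroup (Fin 2) ℂ) with hdU
  set dV := fieldMeasure (F.P i) 0 ↥(Matrix.specialUnitaryGroup (Fin 2) ℂ) with hdV
  haveI : IsProbabilityMeasure dU := Missing.isProbabilityMeasure_fieldMeasure _ _
  haveI : IsProbabilityMeasure dV := Missing.isProbabilityMeasure_fieldMeasure _ _
  have hd : Measurable (descend F ℰp i : GaugeField (F.P (i + 1)) 0 ↥(Matrix.specialUnitaryGroup (Fin 2) ℂ) →
      GaugeField (F.P i) 0 ↥(Matrix.specialUnitaryGroup (Fin 2) ℂ)) := measurable_descend F ℰp measurableE_ℰp i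
  have hac : dU.map (descend F ℰp i) ≪ dV := absolutelyContinuous_map_descend F i
  -- the on-plateau density
  have hρTi : Integrable (T'.indicator ρ) dU := hρi.indicator hTm
  have hρT0 : ∀ U, 0 ≤ T'.indicator ρ U := fun U => Set.indicator_nonneg (fun _ _ => hρ0 _) U
  -- the test function `1_A`
  have hf : Measurable (A.indicator fun _ => (1 : ℝ)) := measurable_const.indicator hA
  have hfC : ∀ V, |A.indicator (fun _ => (1 : ℝ)) V| ≤ 1 := fun V => by
    by_cases hV : V ∈ A
    · simp [hV]
    · simp [hV]
  -- both masses as real integrals against `1_A ∘ descend`, then through the transport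
  have e1 : ν' (descend F ℰp i ⁻¹' A) = ENNReal.ofReal (∫ U, ρ U * A.indicator (fun _ => (1 : ℝ)) (descend F ℰp i U) ∂dU) := by
    rw [hν, withDensity_apply_eq_ofReal_integral_mul_indicator hρi hρ0 (hA.preimage hd)]
    rfl
  have e2 : ν' (descend F ℰp i ⁻¹' A ∩ T') =
      ENNReal.ofReal (∫ U, T'.indicator ρ U * A.indicator (fun _ => (1 : ℝ)) (descend F ℰp i U) ∂dU) := by
    rw [hν, withDensity_apply_eq_ofReal_integral_mul_indicator hρi hρ0 ((hA.preimage hd).inter hTm)]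
    congr 1
    refine integral_congr_ae (ae_of_all _ fun U => ?_)
    by_cases h1 : U ∈ T'
    · by_cases h2 : descend F ℰp i U ∈ A
      · simp [h1, h2]
      · simp [h1, h2]
    · by_cases h2 : descend F ℰp i U ∈ A
      · simp [h1, h2]
      · simp [h1, h2]
  rw [e1, e2, integral_kernelTransport_mul dU dV hd hac hρi hf hfC |>.symm,
    integral_kernelTransport_mul dU dV hd hac hρTi hf hfC |>.symm, ← ENNReal.ofReal_mul (Real.exp_nonneg _), ← integral_const_mul]
  refine ENNReal.ofReal_le_ofReal (integral_mono_ae ?_ ?_ ?_)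
  · exact (integrable_kernelTransport dU dV hd hac hρi).mul_bdd hf.aestronglyMeasurable
      (Filter.Eventually.of_forall fun V => by simpa [Real.norm_eq_abs] using hfC V)
  · exact ((integrable_kernelTransport dU dV hd hac hρTi).mul_bdd hf.aestronglyMeasurable
      (Filter.Eventually.of_forall fun V => by simpa [Real.norm_eq_abs] using hfC V)).const_mul _
  · filter_upwards [hKL] with V hV
    by_cases hVA : V ∈ A
    · have h := hV (hAD hVA)
      simp only [hVA, indicator_of_mem, mul_one]
      exact h
    · simp [hVA]

end Letter

/-! ## §2 Composition with ✓`…S1aDomBGOfOneStepLetters`: the `hdomBG_j` binder of the tower door of record from per-height TRANSPORT letters -/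

section Compose

open Summit.QuantumFields.YangMills.Theorems.FluctuationComparisonRegPrIntLS1aDomBGOfOneStepLetters (hdomBG_of_oneStepLetters)

variable (F : T3Family) {γ : ℝ}
  (ν : ℕ → (j : ℕ) → Measure (GaugeField (F.P j) 0 ↥(Matrix.specialUnitaryGroup (Fin 2) ℂ)))
  {K Ts : ℕ}
  (μ : (j : ℕ) → Measure (GaugeField (F.P j) 0 ↥(Matrix.specialUnitaryGroup (Fin 2) ℂ)))
  (χ : (i : ℕ) → GaugeField (F.P i) 0 ↥(Matrix.specialUnitaryGroup (Fin 2) ℂ) → ℝ)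
  (D T : (i : ℕ) → Set (GaugeField (F.P i) 0 ↥(Matrix.specialUnitaryGroup (Fin 2) ℂ)))
  (ρr : (i : ℕ) → GaugeField (F.P i) 0 ↥(Matrix.specialUnitaryGroup (Fin 2) ℂ) → ℝ)

/-- ★★★ **`hdomBG_j` FROM PER-HEIGHT TRANSPORT LETTERS.**  In the scope of the tower door of record (✓`…S1aAlphaPhiMTowerBG`, with the cut weights also measurable):
given integrable densities `ρr i ≥ 0` of the run laws `ν K i` (`j < i ≤ Ts`; e.g. `Z_K⁻¹·heightDensity … univ`, ✓`…S1aTowerLawSandwich.run_eq_withDensity_heightDensity_univ`),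
the supplier's open domains `D_i` ⊇ (E)-good data and measurable plateau targets `T_i ⊆ D_i`, and for every height `j ≤ i < Ts` the TRANSPORT LETTER
«`T_i(ρr (i+1)) ≤ e^{η_i} · T_i(1_{T_{i+1}}·ρr (i+1))` for `dU_i`-a.e. `V ∈ D_i`» (`T_i` = the one-step kernel transport along `descend F ℰp i`), with `Σ_{i∈[j,Ts)} η_i ≤ Δ`:
the door's letter `hdomBG_j` holds VERBATIM (§1 feeds ✓`hdomBG_of_oneStepLetters`).  Nothing of Bałaban's asserted; the transport letters are HYPOTHESES.
[cite: Balaban1985UV3, (7) p.257, (41) p.266 and (47) p.267] -/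
theorem hdomBG_of_transportLetters
    (hν1 : ∀ K, ν K K = T4GenFunBounds.gibbsMeasure (F.P K) ((F.scheme ℰp γ).β K))
    (hν2 : ∀ K j, j < K → ν K j = Measure.map (descend F ℰp j) (ν K (j + 1)))
    (hTs : Ts ≤ K) (hχm : ∀ i, Measurable (χ i))
    (hanch : ∀ j, Ts ≤ j → μ j = ν K j)
    (hcut : ∀ j, j < Ts → μ j = Measure.map (descend F ℰp j) ((μ (j + 1)).withDensity fun U => ENNReal.ofReal (χ (j + 1) U)))
    (hTm : ∀ i, MeasurableSet (T i)) (hTD : ∀ i, T i ⊆ D i) (η : ℕ → ℝ) {j : ℕ} (hjK : j ≤ K)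
    (hplat : ∀ (i : ℕ), j < i → i ≤ Ts → ∀ U ∈ T i, χ i U = 1)
    (hρi : ∀ i, j < i → i ≤ Ts → Integrable (ρr i) (fieldMeasure (F.P i) 0 ↥(Matrix.specialUnitaryGroup (Fin 2) ℂ)))
    (hρ0 : ∀ i U, 0 ≤ ρr i U)
    (hνρ : ∀ i, j < i → i ≤ Ts → ν K i = (fieldMeasure (F.P i) 0 ↥(Matrix.specialUnitaryGroup (Fin 2) ℂ)).withDensity fun U => ENNReal.ofReal (ρr i U))
    (hKL : ∀ (i : ℕ), j ≤ i → i < Ts → ∀ᵐ V ∂(fieldMeasure (F.P i) 0 ↥(Matrix.specialUnitaryGroup (Fin 2) ℂ)), V ∈ D i →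
      kernelTransport (fieldMeasure (F.P (i + 1)) 0 ↥(Matrix.specialUnitaryGroup (Fin 2) ℂ)) (fieldMeasure (F.P i) 0 ↥(Matrix.specialUnitaryGroup (Fin 2) ℂ))
          (descend F ℰp i) (ρr (i + 1)) V ≤
        Real.exp (η i) * kernelTransport (fieldMeasure (F.P (i + 1)) 0 ↥(Matrix.specialUnitaryGroup (Fin 2) ℂ))
          (fieldMeasure (F.P i) 0 ↥(Matrix.specialUnitaryGroup (Fin 2) ℂ)) (descend F ℰp i) ((T (i + 1)).indicator (ρr (i + 1))) V)
    (hDo : IsOpen (D j)) {Δ : ℝ} (hΔ : ∑ i ∈ Finset.Ico j Ts, η i ≤ Δ)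
    (ρc ρt : GaugeField (F.P j) 0 ↥(Matrix.specialUnitaryGroup (Fin 2) ℂ) → ℝ) (hcc : Continuous ρc) (htc : Continuous ρt) (hc0 : ∀ V, 0 ≤ ρc V)
    (hμc : μ j = (fieldMeasure (F.P j) 0 ↥(Matrix.specialUnitaryGroup (Fin 2) ℂ)).withDensity fun V => ENNReal.ofReal (ρc V))
    (hνt : ν K j = (fieldMeasure (F.P j) 0 ↥(Matrix.specialUnitaryGroup (Fin 2) ℂ)).withDensity fun V => ENNReal.ofReal (ρt V))
    {θ R₀ : ℝ}
    (hgood : ∀ V : GaugeField (F.P K) (K - j) ↥(Matrix.specialUnitaryGroup (Fin 2) ℂ), PlaqSmall θ V →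
      (∃ U₀ : GaugeField (F.P K) 0 ↥(Matrix.specialUnitaryGroup (Fin 2) ℂ),
          IsBackground (fun i => BlockAveraging.blockAvg (P := F.P K) (j := i) ℰp) {U | PlaqSmall R₀ U} (K - j) V U₀ ∧
          PlaqSmall (θ * ((F.L : ℝ)⁻¹) ^ (2 * (K - j))) U₀) →
      fieldShift (BalabanUVClass.heightShift_eq F hjK) V ∈ D j) :
    ∀ V : GaugeField (F.P K) (K - j) ↥(Matrix.specialUnitaryGroup (Fin 2) ℂ), PlaqSmall θ V →
      (∃ U₀ : GaugeField (F.P K) 0 ↥(Matrix.specialUnitaryGroup (Fin 2) ℂ),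
          IsBackground (fun i => BlockAveraging.blockAvg (P := F.P K) (j := i) ℰp) {U | PlaqSmall R₀ U} (K - j) V U₀ ∧
          PlaqSmall (θ * ((F.L : ℝ)⁻¹) ^ (2 * (K - j))) U₀) →
      BalabanUVClass.readAtLevel F hjK ρt V ≤ Real.exp Δ * BalabanUVClass.readAtLevel F hjK ρc V :=
  hdomBG_of_oneStepLetters F ν μ χ D T hν1 hν2 hTs hχm hanch hcut hTm hTD η hjK hplat
    (fun i hji hiT _ hA hAD => oneStepLetter_of_transportBound F i (hρi (i + 1) (by omega) (by omega)) (hρ0 (i + 1))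
      (hνρ (i + 1) (by omega) (by omega)) (D i) (hTm (i + 1)) (hKL i hji hiT) hA hAD)
    hDo hΔ ρc ρt hcc htc hc0 hμc hνt hgood

end Compose

/-! ## §3 The same with Bałaban's own densities of the run: `ρr i := Z_K⁻¹ · ρ^{univ}_{K−i}` (✓`…S1aTowerLawSandwich.run_eq_withDensity_heightDensity_univ`) -/

section Print

open Summit.QuantumFields.YangMills.Theorems.FluctuationComparisonRegPrIntLS1aDomBGOfOneStepLetters (hdomBG_of_oneStepLetters)
open Summit.QuantumFields.YangMills.Theorems.FluctuationComparisonRegPrIntLS1aTowerLawSandwich (run_eq_withDensity_heightDensity_univ)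
open T3TiltDescent T3UnitScaleTilt
open Literature.MathematicalPhysics.QuantumFieldTheory.Balaban1983to89.Missing (partitionFn partitionFn_pos')

variable (F : T3Family) {γ : ℝ}
  (ν : ℕ → (j : ℕ) → Measure (GaugeField (F.P j) 0 ↥(Matrix.specialUnitaryGroup (Fin 2) ℂ)))
  {K Ts : ℕ}
  (μ : (j : ℕ) → Measure (GaugeField (F.P j) 0 ↥(Matrix.specialUnitaryGroup (Fin 2) ℂ)))
  (χ : (i : ℕ) → GaugeField (F.P i) 0 ↥(Matrix.specialUnitaryGroup (Fin 2) ℂ) → ℝ)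
  (D T : (i : ℕ) → Set (GaugeField (F.P i) 0 ↥(Matrix.specialUnitaryGroup (Fin 2) ℂ)))

/-- ★★★ **`hdomBG_j` FROM PER-HEIGHT TRANSPORT LETTERS ON BAŁABAN'S RENORMALISED DENSITIES.**  As ✓`hdomBG_of_transportLetters`, with the run's densities taken to be
print's own objects `ρ_{K−(i+1)}` of run `K` read at height `i+1` (lit `T3TiltDescent.heightDensity … univ`; the normalisation `Z_K⁻¹` is immaterial to a RELATIVE bound and is
removed by linearity of the transport, §0b): the TRANSPORT LETTER at height `i` reads
«`T_i(ρ_{K−(i+1)}) ≤ e^{η_i} · T_i(1_{T_{i+1}}·ρ_{K−(i+1)})` for `dU_i`-a.e. `V ∈ D_i`» — the renormalization transform of the WHOLE renormalised density is at most `e^{η_i}` times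
that of its on-plateau part, on the good data ([Balaban1985UV3] (7) p.257 inserted at ONE level, (47) p.267's mechanism).  `γ ≥ 0`.  Nothing of Bałaban's asserted; the letters
are HYPOTHESES. [cite: Balaban1985UV3, (2) p.256, (7) p.257, (41) p.266 and (47) p.267] -/
theorem hdomBG_of_transportLetters_heightDensity (hγ : 0 ≤ γ)
    (hν1 : ∀ K, ν K K = T4GenFunBounds.gibbsMeasure (F.P K) ((F.scheme ℰp γ).β K))
    (hν2 : ∀ K j, j < K → ν K j = Measure.map (descend F ℰp j) (ν K (j + 1)))
    (hTs : Ts ≤ K) (hχm : ∀ i, Measurable (χ i))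
    (hanch : ∀ j, Ts ≤ j → μ j = ν K j)
    (hcut : ∀ j, j < Ts → μ j = Measure.map (descend F ℰp j) ((μ (j + 1)).withDensity fun U => ENNReal.ofReal (χ (j + 1) U)))
    (hTm : ∀ i, MeasurableSet (T i)) (hTD : ∀ i, T i ⊆ D i) (η : ℕ → ℝ) {j : ℕ} (hjK : j ≤ K)
    (hplat : ∀ (i : ℕ), j < i → i ≤ Ts → ∀ U ∈ T i, χ i U = 1)
    (hKL : ∀ (i : ℕ), j ≤ i → ∀ (hiT : i < Ts), ∀ᵐ V ∂(fieldMeasure (F.P i) 0 ↥(Matrix.specialUnitaryGroup (Fin 2) ℂ)), V ∈ D i →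
      kernelTransport (fieldMeasure (F.P (i + 1)) 0 ↥(Matrix.specialUnitaryGroup (Fin 2) ℂ)) (fieldMeasure (F.P i) 0 ↥(Matrix.specialUnitaryGroup (Fin 2) ℂ))
          (descend F ℰp i) (heightDensity F γ (Nat.succ_le_of_lt (hiT.trans_le hTs)) Set.univ) V ≤
        Real.exp (η i) * kernelTransport (fieldMeasure (F.P (i + 1)) 0 ↥(Matrix.specialUnitaryGroup (Fin 2) ℂ))
          (fieldMeasure (F.P i) 0 ↥(Matrix.specialUnitaryGroup (Fin 2) ℂ)) (descend F ℰp i)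
          ((T (i + 1)).indicator (heightDensity F γ (Nat.succ_le_of_lt (hiT.trans_le hTs)) Set.univ)) V)
    (hDo : IsOpen (D j)) {Δ : ℝ} (hΔ : ∑ i ∈ Finset.Ico j Ts, η i ≤ Δ)
    (ρc ρt : GaugeField (F.P j) 0 ↥(Matrix.specialUnitaryGroup (Fin 2) ℂ) → ℝ) (hcc : Continuous ρc) (htc : Continuous ρt) (hc0 : ∀ V, 0 ≤ ρc V)
    (hμc : μ j = (fieldMeasure (F.P j) 0 ↥(Matrix.specialUnitaryGroup (Fin 2) ℂ)).withDensity fun V => ENNReal.ofReal (ρc V))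
    (hνt : ν K j = (fieldMeasure (F.P j) 0 ↥(Matrix.specialUnitaryGroup (Fin 2) ℂ)).withDensity fun V => ENNReal.ofReal (ρt V))
    {θ R₀ : ℝ}
    (hgood : ∀ V : GaugeField (F.P K) (K - j) ↥(Matrix.specialUnitaryGroup (Fin 2) ℂ), PlaqSmall θ V →
      (∃ U₀ : GaugeField (F.P K) 0 ↥(Matrix.specialUnitaryGroup (Fin 2) ℂ),
          IsBackground (fun i => BlockAveraging.blockAvg (P := F.P K) (j := i) ℰp) {U | PlaqSmall R₀ U} (K - j) V U₀ ∧
          PlaqSmall (θ * ((F.L : ℝ)⁻¹) ^ (2 * (K - j))) U₀) →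
      fieldShift (BalabanUVClass.heightShift_eq F hjK) V ∈ D j) :
    ∀ V : GaugeField (F.P K) (K - j) ↥(Matrix.specialUnitaryGroup (Fin 2) ℂ), PlaqSmall θ V →
      (∃ U₀ : GaugeField (F.P K) 0 ↥(Matrix.specialUnitaryGroup (Fin 2) ℂ),
          IsBackground (fun i => BlockAveraging.blockAvg (P := F.P K) (j := i) ℰp) {U | PlaqSmall R₀ U} (K - j) V U₀ ∧
          PlaqSmall (θ * ((F.L : ℝ)⁻¹) ^ (2 * (K - j))) U₀) →
      BalabanUVClass.readAtLevel F hjK ρt V ≤ Real.exp Δ * BalabanUVClass.readAtLevel F hjK ρc V := by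
  have hZ : 0 < partitionFn (G := ↥(Matrix.specialUnitaryGroup (Fin 2) ℂ)) (F.P K) ((F.scheme ℰp γ).β K) :=
    partitionFn_pos' _ (F.scheme_β_nonneg ℰp hγ K)
  refine hdomBG_of_oneStepLetters F ν μ χ D T hν1 hν2 hTs hχm hanch hcut hTm hTD η hjK hplat (fun i hji hiT _ hA hAD => ?_)
    hDo hΔ ρc ρt hcc htc hc0 hμc hνt hgood
  have hi1K : i + 1 ≤ K := Nat.succ_le_of_lt (hiT.trans_le hTs)
  obtain ⟨_, hdi⟩ := heightDensity_props F hi1K MeasurableSet.univ hγ (γ := γ) (S := Set.univ)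
  refine oneStepLetter_of_transportBound F i (hdi.const_mul _) (fun U => mul_nonneg (inv_pos.mpr hZ).le (heightDensity_nonneg F γ hi1K Set.univ U))
    (run_eq_withDensity_heightDensity_univ F hγ ν hν1 hν2 hi1K) (D i) (hTm (i + 1)) ?_ hA hAD
  filter_upwards [hKL i hji hiT] with V hV hVD
  exact transportBound_const_mul _ _ _ (inv_pos.mpr hZ).le _ _ _ (hV hVD)

end Print

end Summit.QuantumFields.YangMills.Theorems.FluctuationComparisonRegPrIntLS1aOneStepLetterOfTransportBound

end
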